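import Mathlib
import Summits.CriticalPhenomena.PercolationContinuityZ3.Theorems.PercNearOneGluingNoHeavyLowerTailFatMinorityInduction
import Summits.CriticalPhenomena.PercolationContinuityZ3.Theorems.PercNearOneGluingNoHeavyLowerTailFatMinorityOnePortCertificate
import HarnessLib

/-!
# `NoHeavyLowerTail` (stmt-CriticalPhenomena-4575), line fat-minority-linear — the residual of the (UT4, QUT4) induction as a
# THRESHOLD-FREE monotonicity statement (route task `nh-dp-fatminority`, gen 11; FINDINGS-fat-minority-gen11 §4)

Notation of `…FatMinorityInduction`: `μ = prodBernoulli w`, observer `o ∉ A` isolated off `A` (no loop), `U = U_𝒰` the star up-event of an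
up-set `𝒰 ⊆ 𝒫(A)`, `μ₁ᶻ = μ_{w[s(o,z)↦1]}`.

(MONO′) — conjecture of the notes, gen 11: if NO singleton `{z}` is a member of `𝒰` and `μ₁ᶻ(c↔b) ≤ μ₁ᶻ(z↔b)` for every port `z ∈ A`
("Case II": given any single open pair at the observer, `c` is at most as likely to reach `b` as the observer), then
`μ({c↔b} ∩ U) ≤ μ({o↔b} ∩ U)`.  (With singleton members this is false — Kozma–Nitzan's 'attached' event at two ports is a counterexample.)

* `mono_of_commonPort`: (MONO′) HOLDS whenever the members of `𝒰` have a common port `a` (all cells contain `a`): it is the one-port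
  bracket `onePort_bracket` (BHK Thm 1.5) read on `U = U^a`.  In particular it holds for every principal up-set.
* `upsetStar_target_of_mono`: (MONO′), assumed for the no-singleton up-sets of every weighting on `Fin n` with observer `o` and target `b`,
  implies TARGET (the up-set star inequality UT4 + QUT4 with every admissible threshold) for every weighting, port set and up-set —
  immediate from `upsetStar_target_of_caseII`, since in Case II (MONO′) gives `μ({c↔b} ∩ U) − μ({o↔b} ∩ U) ≤ 0 ≤ t·μ(U)`.
So the whole fat-minority chain (UT4, QUT4, RT4 via `rt4_of_ut4`) rests on (MONO′) for the no-singleton, no-common-port up-sets.  No definitions.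
-/

namespace Summit.CriticalPhenomena.PercolationContinuityZ3.Theorems

open MeasureTheory Set
open Literature.Probability.LatticeModels (prodBernoulli)
open Literature.Probability.Percolation

noncomputable section
open scoped Classical

variable {n : ℕ}

/-- **(MONO′) for common-port up-sets.**  If every member of `𝒰` contains the port `a` and `μ₁ᵃ(c↔b) ≤ μ₁ᵃ(a↔b)`
(`μ₁ᵃ = μ_{w[s(o,a)↦1]}`), then `μ({c↔b} ∩ U) ≤ μ({o↔b} ∩ U)`.  Proof: `U = {s(o,a) open} ∩ U`, and the signed one-port bracket
`onePort_bracket` (BHK Thm 1.5 in the conditioned law) has the sign of `μ₁ᵃ(c↔b) − μ₁ᵃ(a↔b)`; if `{c ↮ a}` is `μ₁ᵃ`-null the two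
events agree. [cite: VandenbergHaggstromKahn2005, Thm. 1.5 (p. 7); KozmaNitzan2024, Lemma 3 p. 6] -/
theorem mono_of_commonPort (w : Sym2 (Fin n) → unitInterval) (A : Finset (Fin n)) (o a c b : Fin n)
    (hoA : o ∉ A) (haA : a ∈ A) (𝒰 : Finset (Finset (Fin n))) (h𝒰A : 𝒰 ⊆ A.powerset)
    (hcommon : ∀ B ∈ 𝒰, a ∈ B)
    (hII : (prodBernoulli (Function.update w s(o, a) 1)).real (openConn c b) ≤
      (prodBernoulli (Function.update w s(o, a) 1)).real (openConn a b)) :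
    (prodBernoulli w).real (openConn c b ∩ {ω | ∃ B ∈ 𝒰, ∀ u ∈ B, s(o, u) ∈ ω}) ≤
      (prodBernoulli w).real (openConn o b ∩ {ω | ∃ B ∈ 𝒰, ∀ u ∈ B, s(o, u) ∈ ω}) := by
  set μ := prodBernoulli w with hμ
  set μ₁ := prodBernoulli (Function.update w s(o, a) 1) with hμ₁
  set U : Set (BondConfig (Fin n)) := {ω | ∃ B ∈ 𝒰, ∀ u ∈ B, s(o, u) ∈ ω} with hU
  have hao : a ≠ o := fun h => hoA (h ▸ haA)
  -- every member contains `a`: `U ⊆ {e open}`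
  have hUa : ({ω : BondConfig (Fin n) | s(o, a) ∈ ω} ∩ U) = U := by
    refine Set.inter_eq_self_of_subset_right fun ω hω => ?_
    obtain ⟨B, hB, hop⟩ := hω
    exact hop a (hcommon B hB)
  have hbr := onePort_bracket w A o a c b hoA haA 𝒰 h𝒰A
  rw [hUa] at hbr
  -- hbr : μ₁(D) * (μ(cb ∩ U) − μ(ob ∩ U)) ≤ w(e) * μ₁(D ∩ U) * (μ₁(cb) − μ₁(ab)),  D = {c ↮ a}
  by_cases hD : μ₁.real (openConn c a)ᶜ = 0
  · -- `c ↔ a` almost surely under `μ₁`: the two events agree on `U ⊆ {e open}`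
    have hUopen : U ⊆ {ω | s(o, a) ∈ ω} := fun ω hω => by
      obtain ⟨B, hB, hop⟩ := hω; exact hop a (hcommon B hB)
    have hc : μ.real (openConn c b ∩ U) = (w s(o, a) : ℝ) * μ₁.real (openConn c b ∩ U) :=
      real_of_subset_edgeOpen w s(o, a) _ (fun ω hω => hUopen hω.2)
    have hset : (openConn o b : Set (BondConfig (Fin n))) ∩ U = openConn a b ∩ U := by
      have h := openConn_inter_edgeOpen_eq hao b U
      rw [hUa] at h
      exact h
    have ho : μ.real (openConn o b ∩ U) = (w s(o, a) : ℝ) * μ₁.real (openConn a b ∩ U) := by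
      rw [hset]
      exact real_of_subset_edgeOpen w s(o, a) _ (fun ω hω => hUopen hω.2)
    rw [hc, ho, real_openConn_inter_eq_of_notConn_null μ₁ c a b U hD]
  · have hpos : 0 < μ₁.real (openConn c a)ᶜ := lt_of_le_of_ne measureReal_nonneg (Ne.symm hD)
    have hwe : 0 ≤ (w s(o, a) : ℝ) := (w s(o, a)).2.1
    have hDU : 0 ≤ μ₁.real ((openConn c a)ᶜ ∩ U) := measureReal_nonneg
    have hrhs : (w s(o, a) : ℝ) * μ₁.real ((openConn c a)ᶜ ∩ U) *
        (μ₁.real (openConn c b) - μ₁.real (openConn a b)) ≤ 0 :=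
      mul_nonpos_of_nonneg_of_nonpos (mul_nonneg hwe hDU) (by linarith)
    nlinarith [hbr, hrhs, hpos]

/-- **TARGET from (MONO′).**  If (MONO′) holds for every weighting on `Fin n` with observer `o` and target `b` (no singleton member of
`𝒰`, Case II at every port), then the up-set star inequality TARGET holds for every weighting, every port set `A ∌ o` (observer isolated
off `A`, no loop), every up-set `𝒰 ∌ ∅`, every `c ≠ o` and every admissible threshold `t` — by `upsetStar_target_of_caseII`.
[cite: KozmaNitzan2024, Thm. 4 p. 13, Lemma 3 p. 6, Lemma 4 p. 9, Lemma 5 p. 13; VandenbergHaggstromKahn2005, Thm. 1.4/1.5 (p. 7); reduction: route notes gen 11 §4] -/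
theorem upsetStar_target_of_mono (o b : Fin n)
    (hMONO : ∀ (w : Sym2 (Fin n) → unitInterval) (A : Finset (Fin n)) (c : Fin n) (𝒰 : Finset (Finset (Fin n))),
      o ∉ A → (∀ u, u ≠ o → u ∉ A → w s(o, u) = 0) → w s(o, o) = 0 → c ≠ o →
      𝒰 ⊆ A.powerset → ∅ ∉ 𝒰 → (∀ B ∈ 𝒰, ∀ B' ∈ A.powerset, B ⊆ B' → B' ∈ 𝒰) →
      (∀ z ∈ A, ({z} : Finset (Fin n)) ∉ 𝒰) →
      (∀ z ∈ A, (prodBernoulli (Function.update w s(o, z) 1)).real (openConn c b) ≤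
        (prodBernoulli (Function.update w s(o, z) 1)).real (openConn z b)) →
      (prodBernoulli w).real (openConn c b ∩ {ω | ∃ B ∈ 𝒰, ∀ u ∈ B, s(o, u) ∈ ω}) ≤
        (prodBernoulli w).real (openConn o b ∩ {ω | ∃ B ∈ 𝒰, ∀ u ∈ B, s(o, u) ∈ ω}))
    (k : ℕ) :
    ∀ (w : Sym2 (Fin n) → unitInterval) (A : Finset (Fin n)), A.card ≤ k → o ∉ A →
      (∀ u, u ≠ o → u ∉ A → w s(o, u) = 0) → w s(o, o) = 0 →
      ∀ 𝒰 : Finset (Finset (Fin n)), 𝒰 ⊆ A.powerset → ∅ ∉ 𝒰 →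
        (∀ B ∈ 𝒰, ∀ B' ∈ A.powerset, B ⊆ B' → B' ∈ 𝒰) →
        ∀ c : Fin n, c ≠ o → ∀ t : ℝ, 0 ≤ t →
          (∀ v ∈ A, (prodBernoulli w).real (openConn c b) - (prodBernoulli w).real (openConn v b) ≤ t) →
          (prodBernoulli w).real (openConn c b ∩ {ω | ∃ B ∈ 𝒰, ∀ u ∈ B, s(o, u) ∈ ω}) -
              (prodBernoulli w).real (openConn o b ∩ {ω | ∃ B ∈ 𝒰, ∀ u ∈ B, s(o, u) ∈ ω}) ≤
            t * (prodBernoulli w).real {ω | ∃ B ∈ 𝒰, ∀ u ∈ B, s(o, u) ∈ ω} := by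
  refine upsetStar_target_of_caseII o b ?_ k
  intro w A c 𝒰 t hoA hiso hloop hco h𝒰A h0 hup hsing hII ht0 _hgap
  have h := hMONO w A c 𝒰 hoA hiso hloop hco h𝒰A h0 hup hsing (fun z hz => (hII z hz).le)
  have hU : 0 ≤ (prodBernoulli w).real {ω : BondConfig (Fin n) | ∃ B ∈ 𝒰, ∀ u ∈ B, s(o, u) ∈ ω} :=
    measureReal_nonneg
  nlinarith [h, hU, ht0]

end

end Summit.CriticalPhenomena.PercolationContinuityZ3.Theorems
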